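import Literature.Geometry.Riemannian.RicciFlowScalarMaximumPrinciple
import HarnessLib

/-!
# The maximum principle with a differential inequality only at spatial maxima
(topic `Geometry/Riemannian`)

Fifth layer of the DeTurck decomposition of the named fact
`Literature.Geometry.Riemannian.ricciFlow_uniqueness` (`RicciFlow.lean`; Hamilton 1982,
Thm. 5.1; Topping 2006, Thm. 5.2.2): generic tools for the proof of uniqueness of the
Ricci–DeTurck flow on a closed manifold (hypothesis (RU) of `RicciDeTurckReduction.lean`;
Andrews–Hopper 2011, §5.4.2, Step 1, "standard theory" of strictly parabolic systems) by the
maximum principle applied to `u = |g₁ - g₂|²_h`. For a SYSTEM the differential inequality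
`∂ₜu ≤ Δu + ⟨X, ∇u⟩ + Cu` is not available at every point in the form required by
`weakMaximumPrinciple` (`RicciFlowScalarMaximumPrinciple.lean`, Topping 2006, Thm. 3.1.1); what
the computation in a chart gives is the ordinary differential inequality `∂ₜu ≤ C u` AT A SPATIAL
MAXIMUM, where `∇u = 0` and the elliptic part is `≤ 0`. This file PROVES the corresponding
maximum-point form of the maximum principle, with minimal regularity, and the sign of metric
traces used to produce the inequality there. Everything is
proved; no named fact and no `sorry` is introduced; no manifold structure is used in the
maximum principle itself.

## Contents (all proved)

* **`le_zero_of_deriv_le_mul_at_isMaxOn`** — on a compact space `M`: if `u` is continuous on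
  `M × [0, T]`, has a time derivative `u'` within `[0, T]` everywhere, `u' ≤ C u` at every
  spatial maximum with `u > 0` and `t > 0`, and `u(0, ·) ≤ 0`, then `u ≤ 0` on `[0, T]`
  (the argument of Topping 2006, Thm. 3.1.1, p. 35, with `e^{-Lt} u`, `L = |C| + 1`).
* `trace_nonpos_of_forall_apply_self_nonpos`, `trace_nonneg_of_forall_apply_self_nonneg` — the
  metric trace of a form `S` with `S(v, v) ≤ 0` (resp. `≥ 0`) against a metric positive
  definite at the point is `≤ 0` (resp. `≥ 0`) (orthonormal bases,
  `trace_eq_sum_of_isOrthonormalFrame`); combined with the second-order condition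
  `D²f(y₀)(v, v) ≤ 0` at an interior local maximum (already in the tree:
  `Literature.Topology.FourManifolds.IsLocalMax.fderiv_fderiv_apply_self_nonpos`,
  `MorseExtrema.lean`) this is the step "`gⁱʲ ∂ᵢ∂ⱼ u ≤ 0` at a maximum" (Topping 2006,
  proof of Thm. 3.1.1: `Δu(x, t₀) ≤ 0`).

## References

* P. Topping, *Lectures on the Ricci flow*, LMS Lecture Note Series 325, Cambridge Univ. Press
  2006, §3.1, Thm. 3.1.1 with its proof (p. 35). [Topping2006]
* B. Andrews, C. Hopper, *The Ricci flow in Riemannian geometry*, LNM 2011 (2011), §5.4.2,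
  Step 1. [AndrewsHopper2011]
-/

noncomputable section

open Bundle Set Filter Module Function
open scoped Manifold ContDiff Topology

namespace Literature.Geometry.Riemannian

open Lorentzian Lorentzian.PseudoRiemannianMetric

/-! ### The maximum principle at spatial maxima -/

section MaxPoint

variable {M : Type*} [TopologicalSpace M] [CompactSpace M]

/-- **Maximum principle, maximum-point form.** Let `M` be a compact space, `0 < T`, and
`u : [0, T] × M → ℝ` continuous on `M × [0, T]` with a time derivative `u'(t, x)` within `[0, T]`
at every point. Suppose that at every `t ∈ (0, T]` and every SPATIAL MAXIMUM `x` of `u(t, ·)`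
with `u(t, x) > 0` the ordinary differential inequality `u'(t, x) ≤ C u(t, x)` holds, for a
fixed constant `C`. If `u(0, ·) ≤ 0` then `u ≤ 0` on `[0, T] × M`. This is the form in which
the weak maximum principle is applied to systems (to `u = |g₁ - g₂|²`, where only the value of
`∂ₜu - Δu` at a maximum point is controlled); the proof is that of Topping 2006, Thm. 3.1.1
(p. 35: maximise `e^{-Lt} u` over the compact `M × [0, T]`; at a positive maximum `(x₀, t₀)` one
has `t₀ > 0`, `x₀` is a spatial maximum, and `∂ₜ(e^{-Lt}u) ≥ 0` from the left, so
`L u ≤ u' ≤ C u`, impossible for `L > C`), with the spatial information entering only through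
the hypothesis. No manifold structure and no regularity beyond continuity and the time
derivative are needed. [cite: Topping2006, Thm. 3.1.1 (proof, p. 35)] -/
theorem le_zero_of_deriv_le_mul_at_isMaxOn {T : ℝ} {u u' : ℝ → M → ℝ}
    (hcont : ContinuousOn (fun p : M × ℝ ↦ u p.2 p.1) (univ ×ˢ Icc 0 T))
    (hderiv : ∀ t ∈ Icc 0 T, ∀ x, HasDerivWithinAt (fun s ↦ u s x) (u' t x) (Icc 0 T) t)
    (C : ℝ) (hmax : ∀ t ∈ Ioc 0 T, ∀ x, IsMaxOn (u t) univ x → 0 < u t x → u' t x ≤ C * u t x)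
    (hu0 : ∀ x, u 0 x ≤ 0) : ∀ t ∈ Icc 0 T, ∀ x, u t x ≤ 0 := by
  intro t ht x
  by_contra hcon
  push Not at hcon
  set K₀ : Set (M × ℝ) := univ ×ˢ Icc 0 T with hK₀
  have hK₀c : IsCompact K₀ := isCompact_univ.prod isCompact_Icc
  set L : ℝ := |C| + 1 with hL
  have hLC : C < L := by
    rw [hL]
    linarith [le_abs_self C]
  -- the auxiliary function `w = e^{-Lt} u` and its maximum over `M × [0, T]`
  set wf : M × ℝ → ℝ := fun p ↦ Real.exp (-L * p.2) * u p.2 p.1 with hwf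
  have hwc : ContinuousOn wf K₀ :=
    ((Real.continuous_exp.comp (continuous_const.mul continuous_snd)).continuousOn).mul hcont
  obtain ⟨q₀, hq₀, hq₀max⟩ := hK₀c.exists_isMaxOn ⟨(x, t), ⟨mem_univ _, ht⟩⟩ hwc
  obtain ⟨x₀, t₀⟩ := q₀
  have ht₀ : t₀ ∈ Icc 0 T := hq₀.2
  have hK₀mem : ∀ (y : M) {s : ℝ}, s ∈ Icc 0 T → ((y, s) : M × ℝ) ∈ K₀ := fun y s hs ↦
    ⟨mem_univ y, hs⟩
  -- the maximum value is positive
  have hpos : 0 < u t₀ x₀ := by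
    have h1 : 0 < wf (x, t) := mul_pos (Real.exp_pos _) hcon
    have h2 : wf (x, t) ≤ wf (x₀, t₀) := hq₀max (hK₀mem x ht)
    have h3 : 0 < wf (x₀, t₀) := h1.trans_le h2
    exact (mul_pos_iff_of_pos_left (Real.exp_pos _)).mp h3
  -- hence `t₀ > 0`
  have ht₀0 : 0 < t₀ := by
    rcases ht₀.1.eq_or_lt with h0 | h0
    · exfalso
      subst h0
      linarith [hu0 x₀]
    · exact h0
  -- `x₀` is a spatial maximum of `u t₀`
  have hxmax : IsMaxOn (u t₀) univ x₀ := by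
    intro y _
    have h2 : wf (y, t₀) ≤ wf (x₀, t₀) := hq₀max (hK₀mem y ht₀)
    exact le_of_mul_le_mul_left h2 (Real.exp_pos _)
  -- the differential inequality at `(t₀, x₀)`
  have hineq : u' t₀ x₀ ≤ C * u t₀ x₀ := hmax t₀ ⟨ht₀0, ht₀.2⟩ x₀ hxmax hpos
  -- the time derivative of `w(x₀, ·)` at `t₀` is `≥ 0`
  have hexpd : HasDerivWithinAt (fun s ↦ Real.exp (-L * s)) (-L * Real.exp (-L * t₀))
      (Icc 0 T) t₀ := by
    have h1 : HasDerivAt (fun s : ℝ ↦ -L * s) (-L) t₀ := by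
      simpa using (hasDerivAt_id t₀).const_mul (-L)
    have h2 := h1.exp
    rw [mul_comm] at h2
    exact h2.hasDerivWithinAt
  have hωd : HasDerivWithinAt (fun s ↦ Real.exp (-L * s) * u s x₀)
      (-L * Real.exp (-L * t₀) * u t₀ x₀ + Real.exp (-L * t₀) * u' t₀ x₀) (Icc 0 T) t₀ :=
    hexpd.mul (hderiv t₀ ht₀ x₀)
  have hωmax : IsMaxOn (fun s ↦ Real.exp (-L * s) * u s x₀) (Icc 0 T) t₀ := fun s hs ↦
    hq₀max (hK₀mem x₀ hs)
  have hω' := deriv_nonneg_of_isMaxOn_Icc hωd ht₀0 ht₀.2 hωmax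
  -- so `L u ≤ u'`, contradicting `u' ≤ C u` with `u > 0` and `C < L`
  have hkey : L * u t₀ x₀ ≤ u' t₀ x₀ := by
    have hexp : 0 < Real.exp (-L * t₀) := Real.exp_pos _
    have : 0 ≤ Real.exp (-L * t₀) * (u' t₀ x₀ - L * u t₀ x₀) := by linarith [hω']
    have h4 := (mul_nonneg_iff_of_pos_left hexp).mp this
    linarith
  have : L * u t₀ x₀ ≤ C * u t₀ x₀ := hkey.trans hineq
  nlinarith

end MaxPoint

/-! ### Traces of nonpositive forms against a positive definite metric -/

section Trace

variable {E : Type*} [NormedAddCommGroup E] [NormedSpace ℝ E] {H : Type*} [TopologicalSpace H]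
  {I : ModelWithCorners ℝ E H} {M : Type*} [TopologicalSpace M] [ChartedSpace H M]
  [IsManifold I ∞ M] {n : ℕ∞ω} [FiniteDimensional ℝ E]

/-- **The metric trace of a nonpositive form is nonpositive** for a metric positive definite at
the point: in a `g_x`-orthonormal basis `tr_g S = ∑ᵢ S(bᵢ, bᵢ) ≤ 0`
(`trace_eq_sum_of_isOrthonormalFrame`; the step "`Δu = tr_g Hess u ≤ 0` at a maximum" of
Topping 2006, proof of Thm. 3.1.1). [cite: Topping2006, Thm. 3.1.1 (proof, p. 35)] -/
theorem trace_nonpos_of_forall_apply_self_nonpos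
    (g : PseudoRiemannianMetric I n E (TangentSpace I : M → Type _)) {x : M}
    (hpos : ∀ v : TangentSpace I x, v ≠ 0 → 0 < g.val x v v)
    (S : LinearMap.BilinForm ℝ (TangentSpace I x)) (hS : ∀ v, S v v ≤ 0) : g.trace x S ≤ 0 := by
  obtain ⟨b, hb⟩ := g.exists_basis_isOrthonormalFrame (x := x) hpos rfl
  rw [g.trace_eq_sum_of_isOrthonormalFrame b hb S]
  exact Finset.sum_nonpos fun i _ ↦ hS (b i)

/-- **The metric trace of a nonnegative form is nonnegative** for a metric positive definite at
the point. [folklore] -/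
theorem trace_nonneg_of_forall_apply_self_nonneg
    (g : PseudoRiemannianMetric I n E (TangentSpace I : M → Type _)) {x : M}
    (hpos : ∀ v : TangentSpace I x, v ≠ 0 → 0 < g.val x v v)
    (S : LinearMap.BilinForm ℝ (TangentSpace I x)) (hS : ∀ v, 0 ≤ S v v) : 0 ≤ g.trace x S := by
  obtain ⟨b, hb⟩ := g.exists_basis_isOrthonormalFrame (x := x) hpos rfl
  rw [g.trace_eq_sum_of_isOrthonormalFrame b hb S]
  exact Finset.sum_nonneg fun i _ ↦ hS (b i)

end Trace

end Literature.Geometry.Riemannian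

end
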